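import Summits.QuantumFields.BalabanUV.T4Continuum.Support.OutputRateFunctionalTablesPointwise
import Literature.MathematicalPhysics.QuantumFieldTheory.Balaban1983to89.T4InputCauchyRateTermwise

/-!
# OutputRateFunctionalTablesTermwise — Road D in the FIBRE ∕ TERMWISE currency of the ENDs of record: the family model's
# fibre envelopes, species-Lipschitz form, structural insertion binders and TERMWISE data from their POINTWISE-IN-THE-CHART
# forms, and the ENDs over the ORIGINAL carriers (NE5 crux O1, owner design item R48-F ∕ RULING R49 «Road D OF RECORD»; part 4
# of `OutputRateFunctionalTables`; cell `pub-balaban`, T⁴ fan-out; `HOME/CLAIMS.log` INTENT l.17175, answering the located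
# planning note F-ne5leaf09g9-1 l.16936 ∕ XREAD X1 INFO-4 l.16993 of unit `b2b-balaban-t4-ne5-formalise-leaf-09`)

Unit `b2b-balaban-t4-ne5-formalise-leaf-02` (NE5 formalisation swarm, leaf prover 02, gen 17).  Summits-side NEW WORK under the
LEAN PLACEMENT RULE (cell modelling + bookkeeping over ABSTRACT carriers; NOT a Literature module; nothing printed is asserted,
no `[cite:]` tag, no `Prop`-valued fact is minted — trigger `t4/T4-NE5-TRIGGER.json` c3; the two `def`s are DATA).  HONEST
FRAMING: rung (B)+1 of the FINITE-VOLUME T⁴ continuum programme — NOT infinite volume, NOT a mass gap, NOT the Clay problem, NOT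
a proof of NE5 (NE5 is NOT PRINTED: the series prints ε-UNIFORM bounds, never two-spacing RATES; cell GAPS G-t4-U3-1).  HONEST
DEPENDENCY (cell line, verbatim): continuum YM on T⁴ ⇐ BetaPertH ∧ nine spine estimates (0/9 proved); BetaPertH ⇐ (D1) ∧ (D4) ∧
CAP+tail; G-an2-4 gates asym, D1 and NE2/3/4.

WHY (F-ne5leaf09g9-1, kernel-located by leaf-09 gen 9).  Parts 1–3 (`OutputRateFunctionalTables` p224211 ∕ `…Family` p224773 ∕
`…Pointwise` p225051) transfer the output wall W2 to the family model `FamilySlots.toStepModel` over `paramCarriers C 𝒰` ONLY in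
the JOINT currency (`FamilySlots.outputEnvelope_of_pointwise` ⟹ the kernel's `StepModel.OutputEnvelope`, consumed by C1
`ne5_of_stepModel`), whereas the END faces OF RECORD for Bałaban's (2.14)-terms — E1 `B13StepEnd.ne5_of_assembly`, E8[rec],
E9[rec], the cores road — run on the TERMWISE ∕ FIBRE currency of `T4InputCauchyRateTermwise` (`TermRep` ∕ `TermBound` ∕
`TermBudget` ∕ `TermLineAnalytic` ⟹ `OpFibreEnvelopeCl` ∕ `HistFibreEnvelopeCl` ⟹ `DataLipschitz₂` ⟹
`ne5_at_of_stepModel_termwise_slack_scale_nat`): SEPARATELY analytic fibres, never joint analyticity on `Op × Hist`.  This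
part supplies the missing junctions, so that the (2.14)-roads have a Road-D face.

WHAT ([folklore] bookkeeping, NO estimate; `S : FamilySlots C 𝒰 Op Hist` of part 2 throughout, explicit first argument).
* §1 DATA `famTerm T` — a POINTWISE term family `T : ℕ → ι → Op → Hist → C.Dom × 𝒰 → ℂ` (reading the chart point, as `S.Out`
  does — owner R49 (4)) read at the families' coordinates — and `famClass K` — the family class of a pointwise class
  `K : ℕ → (ℕ → ℝ) → 𝒰 → Set (Op × Hist)`: a family pair is admissible iff admissible AT EVERY chart point.
* §2 FIBRE: `FamilySlots.opFibreEnvelope_of_pointwise` ∕ `histFibreEnvelope_of_pointwise` (the kernel's file-v5 closed-disc shapes;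
  statements and proofs ADOPTED from leaf-09 gen 9's unfiled probe `HOME/b2b-balaban-t4-ne5-formalise-leaf-09/g9/xread/x1/
  ProbeFibreTransfer.lean` sha16 947eaaafa99c60ed — CREDIT: unit `b2b-balaban-t4-ne5-formalise-leaf-09`), their NO-ROOM twins
  `opFibreEnvelopeCl_of_pointwise` ∕ `histFibreEnvelopeCl_of_pointwise` (`DiffContOnCl` on the open unit disc — what the ENDs of
  record consume), and the CONSUMED form `dataLipschitz₂_of_pointwise` (a sup-ball displacement of a family pair dominates the
  displacement of every coordinate; `norm_sub_apply_le`).  Mechanism of all five: a sup-ball direction `𝔲 : Fam 𝒰 Op` evaluates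
  to pointwise directions `‖𝔲 w‖ ≤ ‖𝔲‖ ≤ rOp`, and `(𝔬 + ζ•𝔲) w = 𝔬 w + ζ•𝔲 w` (`lp.coeFn_add` ∕ `lp.coeFn_smul`).
* §3 STRUCTURE: the kernel's `InsBlind` ∕ `InsHomog` (identities, by `lp.ext`) and `InsScaleBound κ E₁ c ω` ∕ `InsertionDampedNat`
  (sup of pointwise bounds, nonempty chart) of `S.toStepModel` from their coordinatewise forms (the binders part 2 does not transfer).
* §4 TERMWISE: `termRep_of_pointwise` (pointwise `HasSum` ⟹ `TermRep S.toStepModel (famClass K) (famTerm T)`),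
  `termBound_of_pointwise`, `termLineAnalytic_of_pointwise` (a family segment with closed unit part in `famClass K` is, at
  every chart point, a pointwise segment in `K k g w`), `boxInClass_of_pointwise` (the sup-box lies in `famClass K` if every
  pointwise box lies in the pointwise class), `classBound_of_pointwise`; `TermBudget a G` is chart-free.
* §5 ENDs OVER THE ORIGINAL CARRIERS (nonempty chart onto the run-B backgrounds), conclusion LITERALLY `T4OutputRate.NE5 EA EB W κ θ′ C₅`
  with the kernel's species constant: `FamilySlots.ne5_of_familySlots_fibreCl` (pointwise weaker fibre envelopes `Gop` ∕ `Ghist` ⟹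
  kernel `ne5_at_of_stepModel_fibreCl₂_scale_nat` over `paramCarriers C 𝒰` ⟹ part 1 `ne5_of_ne5_lift`) and
  `FamilySlots.ne5_of_familySlots_termwise` (pointwise termwise data on a pointwise class containing the pointwise boxes ⟹ kernel
  `ne5_at_of_stepModel_termwise_slack_scale_nat` on `famClass K` ∕ `famTerm T` ⟹ `ne5_of_ne5_lift`) — THE (2.14)-ROADS' ROAD-D FACE.
  Representation ∕ admissibility ∕ affinity stay in the kernel's form (part 2 displays them); every analytic binder is per chart point.
WHAT IS NOT HERE.  No instance (O1 = the substrate cell's `slotsOfRecord` read family-wise; R34); no estimate of [II]; the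
per-background (`PointwiseSlots`) and complex-chart (`𝒰 × Fin 2`, owner g35-b) corollaries are one application each (INTENT l.17175,
OFFER).  Namespace = module (cell CLAIM RULE 4); the sub-namespace `FamilySlots` groups the transfers (explicit `S`, no dot-notation
on part 2's structure).  0 sorry; axioms ⊆ {propext, Classical.choice, Quot.sound}.
-/

noncomputable section

open scoped BigOperators ENNReal
open Finset Function Metric Set

namespace Summit.QuantumFields.BalabanUV.T4Continuum.OutputRateFunctionalTablesTermwise

open Literature.MathematicalPhysics.QuantumFieldTheory.Balaban1983to89
open Literature.MathematicalPhysics.QuantumFieldTheory.Balaban1983to89.T4OutputRate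
open Literature.MathematicalPhysics.QuantumFieldTheory.Balaban1983to89.T4InputCauchyRateData
open Literature.MathematicalPhysics.QuantumFieldTheory.Balaban1983to89.T4InputCauchyRateSpecies
open Literature.MathematicalPhysics.QuantumFieldTheory.Balaban1983to89.T4InputCauchyRateTermwise
open Summit.QuantumFields.BalabanUV.T4Continuum.OutputRateFunctionalTables
open Summit.QuantumFields.BalabanUV.T4Continuum.OutputRateFunctionalTablesFamily

variable {C : Carriers} {𝒰 : Type} {Op Hist : Type*} [NormedAddCommGroup Op] [NormedAddCommGroup Hist] {ι : Type*}

/-! ## §1 Pointwise term families and pointwise classes, read along the chart -/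

/-- [folklore] DATA: a POINTWISE term family `T k i o h (X, u)` (term `i` of the step-`k` expansion at operators `o`, history
`h`, domain `X`, chart point `u`) READ AT THE FAMILIES' COORDINATES: the term family of the family model over `paramCarriers C 𝒰`. -/
def famTerm (T : ℕ → ι → Op → Hist → C.Dom × 𝒰 → ℂ) : ℕ → ι → Fam 𝒰 Op → Fam 𝒰 Hist → C.Dom × 𝒰 → ℂ :=
  fun k i 𝔬 𝔥 p => T k i (𝔬 p.2) (𝔥 p.2) p

/-- [folklore] DATA: the FAMILY CLASS of a pointwise input class `K k g u ⊆ Op × Hist`: a pair (operator family, history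
family) is admissible iff its coordinates are admissible at EVERY chart point (the trivial background slot is not read). -/
def famClass (K : ℕ → (ℕ → ℝ) → 𝒰 → Set (Op × Hist)) :
    ℕ → (ℕ → ℝ) → (paramCarriers C 𝒰).BgB → Set (Fam 𝒰 Op × Fam 𝒰 Hist) :=
  fun k g _ => {p | ∀ u, (p.1 u, p.2 u) ∈ K k g u}

/-- [folklore] The family term family, evaluated. -/
@[simp] theorem famTerm_apply (T : ℕ → ι → Op → Hist → C.Dom × 𝒰 → ℂ) (k : ℕ) (i : ι) (𝔬 : Fam 𝒰 Op) (𝔥 : Fam 𝒰 Hist)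
    (p : C.Dom × 𝒰) : famTerm T k i 𝔬 𝔥 p = T k i (𝔬 p.2) (𝔥 p.2) p := rfl

/-- [folklore] Membership in the family class, displayed. -/
theorem mem_famClass_iff (K : ℕ → (ℕ → ℝ) → 𝒰 → Set (Op × Hist)) (k : ℕ) (g : ℕ → ℝ)
    (v : (paramCarriers C 𝒰).BgB) (p : Fam 𝒰 Op × Fam 𝒰 Hist) :
    p ∈ famClass (C := C) K k g v ↔ ∀ u, (p.1 u, p.2 u) ∈ K k g u := Iff.rfl

/-- [folklore] A coordinate of a family segment is the pointwise segment of the coordinates. -/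
theorem segment_apply {E : Type*} [NormedAddCommGroup E] [NormedSpace ℂ E] (f g : Fam 𝒰 E) (ζ : ℂ) (w : 𝒰) :
    (f + ζ • g) w = f w + ζ • g w := by
  rw [lp.coeFn_add, lp.coeFn_smul, Pi.add_apply, Pi.smul_apply]

namespace FamilySlots

variable [NormedSpace ℂ Op] [NormedSpace ℂ Hist] (S : FamilySlots C 𝒰 Op Hist)

/-! ## §2 The fibre envelopes and the species-Lipschitz form of the family model from their pointwise forms -/

/-- [folklore] **OPERATOR FIBRE ENVELOPE OF THE FAMILY MODEL FROM THE POINTWISE ONE** (kernel file-v5 shape, closed disc): if at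
every chart point `w`, around every base point, for every history `h'` within the margin of `p.2 w` and every operator direction
`u` within the operator margin, `ζ ↦ Out k (p.1 w + ζ•u) h' (X, w)` is complex differentiable on the closed unit disc and bounded
there by `G·e^{−κd(X)}`, then `S.toStepModel` satisfies the kernel's `OpFibreEnvelope W κ G`.  ADOPTED from the probe
`ProbeFibreTransfer.lean` (sha16 947eaaafa99c60ed) of unit `b2b-balaban-t4-ne5-formalise-leaf-09` (gen 9), with credit. -/
theorem opFibreEnvelope_of_pointwise {W : Set (ℕ → ℝ)} {κ G : ℝ}
    (h : ∀ k, ∀ g ∈ W, ∀ p ∈ S.Base k g, ∀ (X : C.Dom) (w : 𝒰), C.scale X = k →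
      ∀ h' ∈ closedBall (p.2 w) (S.rHist k), ∀ u : Op, ‖u‖ ≤ S.rOp k →
        DifferentiableOn ℂ (fun ζ : ℂ => S.Out k (p.1 w + ζ • u) h' (X, w)) (closedBall 0 1) ∧
          ∀ ζ ∈ closedBall (0 : ℂ) 1, ‖S.Out k (p.1 w + ζ • u) h' (X, w)‖ ≤ G * Real.exp (-(κ * C.d X))) :
    S.toStepModel.OpFibreEnvelope W κ G := by
  rintro k g hg _ p hp ⟨X, w⟩ hX 𝔥 h𝔥 𝔲 h𝔲
  have h𝔥' : 𝔥 w ∈ closedBall (p.2 w) (S.rHist k) := by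
    rw [mem_closedBall, dist_eq_norm] at h𝔥 ⊢
    exact (norm_sub_apply_le _ _ _).trans h𝔥
  obtain ⟨hdiff, hbd⟩ := h k g hg p hp X w hX (𝔥 w) h𝔥' (𝔲 w) ((norm_apply_le _ _).trans h𝔲)
  have heq : (fun ζ : ℂ => S.toStepModel.Out k (p.1 + ζ • 𝔲) 𝔥 (X, w)) =
      fun ζ : ℂ => S.Out k (p.1 w + ζ • 𝔲 w) (𝔥 w) (X, w) := funext fun ζ => by
    show S.Out k ((p.1 + ζ • 𝔲) w) (𝔥 w) (X, w) = _
    rw [segment_apply]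
  rw [heq]
  exact ⟨hdiff, hbd⟩

/-- [folklore] **HISTORY FIBRE ENVELOPE OF THE FAMILY MODEL FROM THE POINTWISE ONE** (closed disc; ADOPTED from the same probe of
unit `b2b-balaban-t4-ne5-formalise-leaf-09`, with credit). -/
theorem histFibreEnvelope_of_pointwise {W : Set (ℕ → ℝ)} {κ G : ℝ}
    (h : ∀ k, ∀ g ∈ W, ∀ p ∈ S.Base k g, ∀ (X : C.Dom) (w : 𝒰), C.scale X = k →
      ∀ o ∈ closedBall (p.1 w) (S.rOp k), ∀ v : Hist, ‖v‖ ≤ S.rHist k →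
        DifferentiableOn ℂ (fun ζ : ℂ => S.Out k o (p.2 w + ζ • v) (X, w)) (closedBall 0 1) ∧
          ∀ ζ ∈ closedBall (0 : ℂ) 1, ‖S.Out k o (p.2 w + ζ • v) (X, w)‖ ≤ G * Real.exp (-(κ * C.d X))) :
    S.toStepModel.HistFibreEnvelope W κ G := by
  rintro k g hg _ p hp ⟨X, w⟩ hX 𝔬 h𝔬 𝔳 h𝔳
  have h𝔬' : 𝔬 w ∈ closedBall (p.1 w) (S.rOp k) := by
    rw [mem_closedBall, dist_eq_norm] at h𝔬 ⊢
    exact (norm_sub_apply_le _ _ _).trans h𝔬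
  obtain ⟨hdiff, hbd⟩ := h k g hg p hp X w hX (𝔬 w) h𝔬' (𝔳 w) ((norm_apply_le _ _).trans h𝔳)
  have heq : (fun ζ : ℂ => S.toStepModel.Out k 𝔬 (p.2 + ζ • 𝔳) (X, w)) =
      fun ζ : ℂ => S.Out k (𝔬 w) (p.2 w + ζ • 𝔳 w) (X, w) := funext fun ζ => by
    show S.Out k (𝔬 w) ((p.2 + ζ • 𝔳) w) (X, w) = _
    rw [segment_apply]
  rw [heq]
  exact ⟨hdiff, hbd⟩

/-- [folklore] **THE NO-ROOM OPERATOR FIBRE ENVELOPE OF THE FAMILY MODEL FROM THE POINTWISE ONE** (the shape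
`T4InputCauchyRateTermwise.OpFibreEnvelopeCl` the ENDs of record consume: `DiffContOnCl` on the open unit disc along each operator
segment, envelope on the closed disc — exactly what a uniformly majorised expansion delivers, per chart point). -/
theorem opFibreEnvelopeCl_of_pointwise {W : Set (ℕ → ℝ)} {κ G : ℝ}
    (h : ∀ k, ∀ g ∈ W, ∀ p ∈ S.Base k g, ∀ (X : C.Dom) (w : 𝒰), C.scale X = k →
      ∀ h' ∈ closedBall (p.2 w) (S.rHist k), ∀ u : Op, ‖u‖ ≤ S.rOp k →
        DiffContOnCl ℂ (fun ζ : ℂ => S.Out k (p.1 w + ζ • u) h' (X, w)) (ball 0 1) ∧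
          ∀ ζ ∈ closedBall (0 : ℂ) 1, ‖S.Out k (p.1 w + ζ • u) h' (X, w)‖ ≤ G * Real.exp (-(κ * C.d X))) :
    OpFibreEnvelopeCl S.toStepModel W κ G := by
  rintro k g hg _ p hp ⟨X, w⟩ hX 𝔥 h𝔥 𝔲 h𝔲
  have h𝔥' : 𝔥 w ∈ closedBall (p.2 w) (S.rHist k) := by
    rw [mem_closedBall, dist_eq_norm] at h𝔥 ⊢
    exact (norm_sub_apply_le _ _ _).trans h𝔥
  obtain ⟨hdiff, hbd⟩ := h k g hg p hp X w hX (𝔥 w) h𝔥' (𝔲 w) ((norm_apply_le _ _).trans h𝔲)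
  have heq : (fun ζ : ℂ => S.toStepModel.Out k (p.1 + ζ • 𝔲) 𝔥 (X, w)) =
      fun ζ : ℂ => S.Out k (p.1 w + ζ • 𝔲 w) (𝔥 w) (X, w) := funext fun ζ => by
    show S.Out k ((p.1 + ζ • 𝔲) w) (𝔥 w) (X, w) = _
    rw [segment_apply]
  rw [heq]
  exact ⟨hdiff, hbd⟩

/-- [folklore] **THE NO-ROOM HISTORY FIBRE ENVELOPE OF THE FAMILY MODEL FROM THE POINTWISE ONE** (`HistFibreEnvelopeCl`; the
exponent-critical wall W2-hist, per chart point). -/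
theorem histFibreEnvelopeCl_of_pointwise {W : Set (ℕ → ℝ)} {κ G : ℝ}
    (h : ∀ k, ∀ g ∈ W, ∀ p ∈ S.Base k g, ∀ (X : C.Dom) (w : 𝒰), C.scale X = k →
      ∀ o ∈ closedBall (p.1 w) (S.rOp k), ∀ v : Hist, ‖v‖ ≤ S.rHist k →
        DiffContOnCl ℂ (fun ζ : ℂ => S.Out k o (p.2 w + ζ • v) (X, w)) (ball 0 1) ∧
          ∀ ζ ∈ closedBall (0 : ℂ) 1, ‖S.Out k o (p.2 w + ζ • v) (X, w)‖ ≤ G * Real.exp (-(κ * C.d X))) :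
    HistFibreEnvelopeCl S.toStepModel W κ G := by
  rintro k g hg _ p hp ⟨X, w⟩ hX 𝔬 h𝔬 𝔳 h𝔳
  have h𝔬' : 𝔬 w ∈ closedBall (p.1 w) (S.rOp k) := by
    rw [mem_closedBall, dist_eq_norm] at h𝔬 ⊢
    exact (norm_sub_apply_le _ _ _).trans h𝔬
  obtain ⟨hdiff, hbd⟩ := h k g hg p hp X w hX (𝔬 w) h𝔬' (𝔳 w) ((norm_apply_le _ _).trans h𝔳)
  have heq : (fun ζ : ℂ => S.toStepModel.Out k 𝔬 (p.2 + ζ • 𝔳) (X, w)) =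
      fun ζ : ℂ => S.Out k (𝔬 w) (p.2 w + ζ • 𝔳 w) (X, w) := funext fun ζ => by
    show S.Out k (𝔬 w) ((p.2 + ζ • 𝔳) w) (X, w) = _
    rw [segment_apply]
  rw [heq]
  exact ⟨hdiff, hbd⟩

/-- [folklore] **THE CONSUMED FORM — `DataLipschitz₂` OF THE FAMILY MODEL FROM THE POINTWISE TWO-POINT BOUND**: if at every chart
point `w` the pointwise functional obeys the species two-point bound around every admissible coordinate `(p.1 w, p.2 w)` within
relative reach `ρ₀`, with nonnegative moduli `Λop`, `Λhist` in margin units, then so does `S.toStepModel` in the sup norms — each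
coordinate displacement is at most the family displacement. -/
theorem dataLipschitz₂_of_pointwise {W : Set (ℕ → ℝ)} {κ Λop Λhist ρ₀ : ℝ} (hΛop : 0 ≤ Λop) (hΛhist : 0 ≤ Λhist)
    (h : ∀ k, ∀ g ∈ W, ∀ p ∈ S.Base k g, ∀ (X : C.Dom) (w : 𝒰), C.scale X = k →
      ∀ q : Op × Hist, ‖q.1 - p.1 w‖ ≤ ρ₀ * S.rOp k → ‖q.2 - p.2 w‖ ≤ ρ₀ * S.rHist k →
        ‖S.Out k q.1 q.2 (X, w) - S.Out k (p.1 w) (p.2 w) (X, w)‖ ≤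
          (Λop * (‖q.1 - p.1 w‖ / S.rOp k) + Λhist * (‖q.2 - p.2 w‖ / S.rHist k)) * Real.exp (-(κ * C.d X))) :
    DataLipschitz₂ S.toStepModel W κ Λop Λhist ρ₀ := by
  rintro k g hg _ p hp ⟨X, w⟩ hX q hq1 hq2
  have h1 : ‖q.1 w - p.1 w‖ ≤ ‖q.1 - p.1‖ := norm_sub_apply_le _ _ _
  have h2 : ‖q.2 w - p.2 w‖ ≤ ‖q.2 - p.2‖ := norm_sub_apply_le _ _ _
  have key := h k g hg p hp X w hX (q.1 w, q.2 w) (h1.trans hq1) (h2.trans hq2)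
  refine key.trans (mul_le_mul_of_nonneg_right (add_le_add ?_ ?_) (Real.exp_pos _).le)
  · exact mul_le_mul_of_nonneg_left (div_le_div_of_nonneg_right h1 (S.rOp_pos k).le) hΛop
  · exact mul_le_mul_of_nonneg_left (div_le_div_of_nonneg_right h2 (S.rHist_pos k).le) hΛhist

/-! ## §3 The structural insertion binders of the family model from their coordinatewise forms -/

/-- [folklore] **`InsBlind` OF THE FAMILY MODEL**: if every coordinate of the inserted family reads only the function-table
entries of scales `< k`, so does the family insertion. -/
theorem insBlind_of_pointwise {W : Set (ℕ → ℝ)}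
    (h : ∀ k, ∀ g ∈ W, ∀ (t t' : C.Dom × 𝒰 → ℝ), (∀ Y, C.scale Y < k → ∀ u, t (Y, u) = t' (Y, u)) →
      ∀ u, S.insA g k t u = S.insA g k t' u) :
    S.toStepModel.InsBlind W := by
  intro k g hg _ t t' htt'
  exact lp.ext (funext fun u => h k g hg t t' (fun Y hY u' => htt' (Y, u') hY) u)

/-- [folklore] **`InsHomog` OF THE FAMILY MODEL** from real homogeneity of the table-driven part of every coordinate. -/
theorem insHomog_of_pointwise {W : Set (ℕ → ℝ)}
    (h : ∀ k, ∀ g ∈ W, ∀ (a : ℝ) (t : C.Dom × 𝒰 → ℝ) (u : 𝒰),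
      S.insA g k (a • t) u - S.insA g k 0 u = (a : ℂ) • (S.insA g k t u - S.insA g k 0 u)) :
    S.toStepModel.InsHomog W := by
  intro k g hg _ a t
  refine lp.ext (funext fun u => ?_)
  show (⇑(S.insA g k (a • t) - S.insA g k 0)) u = (⇑((a : ℂ) • (S.insA g k t - S.insA g k 0))) u
  simp only [lp.coeFn_sub, lp.coeFn_smul, Pi.sub_apply, Pi.smul_apply]
  exact h k g hg a t u

/-- [folklore] **`InsScaleBound κ E₁ c ω` OF THE FAMILY MODEL FROM ITS COORDINATEWISE FORM** (nonempty chart; R48-F's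
sup-over-the-background currency): a function table supported on ONE scale `j < k` with entries `≤ E₁·e^{−κd}` at every chart
point displaces every coordinate of the inserted family by `≤ c·ω^{k−1−j}·E₁` margins ⟹ the kernel's single-scale bound. -/
theorem insScaleBound_of_pointwise [Nonempty 𝒰] {W : Set (ℕ → ℝ)} {κ E₁ c ω : ℝ}
    (h : ∀ k, ∀ g ∈ W, ∀ (t : C.Dom × 𝒰 → ℝ) (j : ℕ), j < k → (∀ Y u, C.scale Y ≠ j → t (Y, u) = 0) →
      (∀ Y, C.scale Y = j → ∀ u, |t (Y, u)| ≤ E₁ * Real.exp (-(κ * C.d Y))) →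
        ∀ u, ‖S.insA g k t u - S.insA g k 0 u‖ ≤ S.rHist k * (c * (ω ^ (k - 1 - j) * E₁))) :
    S.toStepModel.InsScaleBound W κ E₁ c ω := by
  intro k g hg _ t j hj hs hb
  exact norm_sub_le_of_forall (h k g hg t j hj (fun Y u hY => hs (Y, u) hY) fun Y hY u => hb (Y, u) hY)

/-- [folklore] **`InsertionDampedNat κ c ω` OF THE FAMILY MODEL FROM ITS COORDINATEWISE FORM** (nonempty chart; printed age
normalisation `ω^{k−1−j}`). -/
theorem insertionDampedNat_of_pointwise [Nonempty 𝒰] {W : Set (ℕ → ℝ)} {κ c ω : ℝ}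
    (h : ∀ k, ∀ g ∈ W, ∀ (t t' : C.Dom × 𝒰 → ℝ) (D : ℕ → ℝ), (∀ j < k, 0 ≤ D j) →
      (∀ Y, C.scale Y < k → ∀ u, |t (Y, u) - t' (Y, u)| ≤ D (C.scale Y) * Real.exp (-(κ * C.d Y))) →
        ∀ u, ‖S.insA g k t u - S.insA g k t' u‖ ≤ S.rHist k * (c * ∑ j ∈ range k, ω ^ (k - 1 - j) * D j)) :
    S.toStepModel.InsertionDampedNat W κ c ω := by
  intro k g hg _ t t' D hD hb
  exact norm_sub_le_of_forall (h k g hg t t' D hD fun Y hY u => hb (Y, u) hY)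

/-! ## §4 The termwise hypothesis shapes of the family model from their pointwise forms -/

/-- [folklore] **`TermRep` OF THE FAMILY MODEL**: if at every chart point `u` and every pointwise class point `q` the pointwise
functional at a step-`k` domain is the sum of the convergent expansion with terms `T k i q.1 q.2 (X, u)`, then `S.toStepModel`
is represented on `famClass K` by `famTerm T`. -/
theorem termRep_of_pointwise {W : Set (ℕ → ℝ)} {K : ℕ → (ℕ → ℝ) → 𝒰 → Set (Op × Hist)}
    {T : ℕ → ι → Op → Hist → C.Dom × 𝒰 → ℂ}
    (h : ∀ k, ∀ g ∈ W, ∀ (u : 𝒰) (q : Op × Hist), q ∈ K k g u → ∀ X : C.Dom, C.scale X = k →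
      HasSum (fun i => T k i q.1 q.2 (X, u)) (S.Out k q.1 q.2 (X, u))) :
    TermRep S.toStepModel (famClass K) (famTerm T) W := by
  rintro k g hg _ q hq ⟨X, u⟩ hX
  exact h k g hg u (q.1 u, q.2 u) (hq u) X hX

omit [NormedSpace ℂ Op] [NormedSpace ℂ Hist] in
/-- [folklore] **`TermBound` OF THE FAMILY TERMS**: pointwise termwise majorants `a k i · e^{−κd(X)}` on the pointwise class give
the same majorants for `famTerm T` on `famClass K`. -/
theorem termBound_of_pointwise {W : Set (ℕ → ℝ)} {K : ℕ → (ℕ → ℝ) → 𝒰 → Set (Op × Hist)}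
    {T : ℕ → ι → Op → Hist → C.Dom × 𝒰 → ℂ} {κ : ℝ} {a : ℕ → ι → ℝ}
    (h : ∀ k, ∀ g ∈ W, ∀ (u : 𝒰) (q : Op × Hist), q ∈ K k g u → ∀ X : C.Dom, C.scale X = k →
      ∀ i, ‖T k i q.1 q.2 (X, u)‖ ≤ a k i * Real.exp (-(κ * C.d X))) :
    TermBound (famClass (C := C) K) (famTerm T) W κ a := by
  rintro k g hg _ q hq ⟨X, u⟩ hX i
  exact h k g hg u (q.1 u, q.2 u) (hq u) X hX i

/-- [folklore] **`TermLineAnalytic` OF THE FAMILY TERMS**: a family segment `(𝔬 + ζ𝔲, 𝔥 + ζ𝔳)` whose closed unit part lies in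
`famClass K` is, at every chart point `w`, the pointwise segment `(𝔬 w + ζ·𝔲 w, 𝔥 w + ζ·𝔳 w)` in `K k g w`; so pointwise per-term
disc analyticity gives that of `famTerm T`. -/
theorem termLineAnalytic_of_pointwise {W : Set (ℕ → ℝ)} {K : ℕ → (ℕ → ℝ) → 𝒰 → Set (Op × Hist)}
    {T : ℕ → ι → Op → Hist → C.Dom × 𝒰 → ℂ}
    (h : ∀ k, ∀ g ∈ W, ∀ (w : 𝒰) (o u : Op) (h₀ v : Hist),
      (∀ ζ ∈ closedBall (0 : ℂ) 1, (o + ζ • u, h₀ + ζ • v) ∈ K k g w) → ∀ X : C.Dom, C.scale X = k →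
        ∀ i, DifferentiableOn ℂ (fun ζ : ℂ => T k i (o + ζ • u) (h₀ + ζ • v) (X, w)) (closedBall 0 1)) :
    TermLineAnalytic (famClass (C := C) K) (famTerm T) W := by
  rintro k g hg _ 𝔬 𝔲 𝔥 𝔳 hseg ⟨X, w⟩ hX i
  have hseg' : ∀ ζ ∈ closedBall (0 : ℂ) 1, (𝔬 w + ζ • 𝔲 w, 𝔥 w + ζ • 𝔳 w) ∈ K k g w := fun ζ hζ => by
    simpa only [segment_apply] using hseg ζ hζ w
  refine (h k g hg w (𝔬 w) (𝔲 w) (𝔥 w) (𝔳 w) hseg' X hX i).congr fun ζ _ => ?_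
  simp only [famTerm_apply, segment_apply]

/-- [folklore] **THE SLACK `BoxInClass` OF THE FAMILY MODEL**: if at every chart point the pointwise two-margin box around every
admissible coordinate lies in the pointwise class, the sup-norm box around every admissible family pair lies in `famClass K`. -/
theorem boxInClass_of_pointwise {W : Set (ℕ → ℝ)} {K : ℕ → (ℕ → ℝ) → 𝒰 → Set (Op × Hist)}
    (h : ∀ k, ∀ g ∈ W, ∀ p ∈ S.Base k g, ∀ u : 𝒰,
      closedBall (p.1 u) (S.rOp k) ×ˢ closedBall (p.2 u) (S.rHist k) ⊆ K k g u) :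
    BoxInClass S.toStepModel (famClass K) W := by
  intro k g hg _ p hp q hq u
  simp only [StepModel.box, mem_prod, mem_closedBall, dist_eq_norm] at hq
  refine h k g hg p hp u (mk_mem_prod ?_ ?_)
  · rw [mem_closedBall, dist_eq_norm]
    exact (norm_sub_apply_le _ _ _).trans hq.1
  · rw [mem_closedBall, dist_eq_norm]
    exact (norm_sub_apply_le _ _ _).trans hq.2

/-- [folklore] **`ClassBound` OF THE FAMILY MODEL** from the pointwise one-run envelope on the pointwise class. -/
theorem classBound_of_pointwise {W : Set (ℕ → ℝ)} {K : ℕ → (ℕ → ℝ) → 𝒰 → Set (Op × Hist)} {κ G : ℝ}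
    (h : ∀ k, ∀ g ∈ W, ∀ (u : 𝒰) (q : Op × Hist), q ∈ K k g u → ∀ X : C.Dom, C.scale X = k →
      ‖S.Out k q.1 q.2 (X, u)‖ ≤ G * Real.exp (-(κ * C.d X))) :
    ClassBound S.toStepModel (famClass K) W κ G := by
  rintro k g hg _ q hq ⟨X, u⟩ hX
  exact h k g hg u (q.1 u, q.2 u) (hq u) X hX

/-! ## §5 ENDs over the ORIGINAL carriers in the fibre ∕ termwise currency -/

/-- [folklore] **NE5 OVER `C` FROM FAMILY SLOTS WITH POINTWISE NO-ROOM FIBRE ENVELOPES, SPECIES-RESOLVED** (nonempty chart onto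
the run-B backgrounds).  Representation of the two runs' lifts, admissibility of run B's family data, the POINTWISE weaker
fibre envelopes with constants `Gop` (W2-op) ∕ `Ghist` (W2-hist), the two runs' decay bounds over `C`, the POINTWISE operator
rate (row NE2's currency) and insertion rate, the structure `InsAffine ∧ InsBlind ∧ InsHomog` of the family insertion with the
POINTWISE single-scale bound `E₁` (W3), the reach ∕ first-scales ∕ smallness numerics (`ω + Ghist·c/(1 − ρ₀) < θ′`) ⟹
`T4OutputRate.NE5 EA EB W κ θ′ C₅` with the constant of `T4InputCauchyRateTermwise.ne5_at_of_stepModel_fibreCl₂_scale_nat`,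
applied over `paramCarriers C 𝒰` and transferred by part 1's `ne5_of_ne5_lift`.  Nothing of the kernel re-proved. -/
theorem ne5_of_familySlots_fibreCl [Nonempty 𝒰] {ρ : 𝒰 → C.BgB} (hρ : Surjective ρ) {EA : Functional C C.BgA}
    {EB : Functional C C.BgB} {W : Set (ℕ → ℝ)} {κ Gop Ghist EA₀ E₀ E₁ δ δ' θ θ' c ω ρ₀ B : ℝ} {k₀ : ℕ}
    (hrA : S.toStepModel.RepresentsA (liftA ρ EA) W) (hrB : S.toStepModel.RepresentsB (liftB ρ EB) W)
    (hbase : S.toStepModel.InBase (liftB ρ EB) W)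
    (hopF : ∀ k, ∀ g ∈ W, ∀ p ∈ S.Base k g, ∀ (X : C.Dom) (w : 𝒰), C.scale X = k →
      ∀ h' ∈ closedBall (p.2 w) (S.rHist k), ∀ u : Op, ‖u‖ ≤ S.rOp k →
        DiffContOnCl ℂ (fun ζ : ℂ => S.Out k (p.1 w + ζ • u) h' (X, w)) (ball 0 1) ∧
          ∀ ζ ∈ closedBall (0 : ℂ) 1, ‖S.Out k (p.1 w + ζ • u) h' (X, w)‖ ≤ Gop * Real.exp (-(κ * C.d X)))
    (hhistF : ∀ k, ∀ g ∈ W, ∀ p ∈ S.Base k g, ∀ (X : C.Dom) (w : 𝒰), C.scale X = k →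
      ∀ o ∈ closedBall (p.1 w) (S.rOp k), ∀ v : Hist, ‖v‖ ≤ S.rHist k →
        DiffContOnCl ℂ (fun ζ : ℂ => S.Out k o (p.2 w + ζ • v) (X, w)) (ball 0 1) ∧
          ∀ ζ ∈ closedBall (0 : ℂ) 1, ‖S.Out k o (p.2 w + ζ • v) (X, w)‖ ≤ Ghist * Real.exp (-(κ * C.d X)))
    (hdA : DecayBound EA W EA₀ κ) (hdB : DecayBound EB W E₀ κ)
    (hop : ∀ k, ∀ g ∈ W, ∀ u : 𝒰, ‖S.opA g k u - S.opB g k u‖ ≤ δ * θ ^ k * S.rOp k)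
    (hins : ∀ k, ∀ g ∈ W, ∀ (t : C.Dom × 𝒰 → ℝ), (∀ Y u, |t (Y, u)| ≤ E₀ * Real.exp (-(κ * C.d Y))) →
      ∀ u, ‖S.insA g k t u - S.insB g k t u‖ ≤ δ' * θ ^ k * S.rHist k)
    (haff : S.toStepModel.InsAffine W) (hblind : S.toStepModel.InsBlind W) (hhom : S.toStepModel.InsHomog W)
    (hunit : ∀ k, ∀ g ∈ W, ∀ (t : C.Dom × 𝒰 → ℝ) (j : ℕ), j < k → (∀ Y u, C.scale Y ≠ j → t (Y, u) = 0) →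
      (∀ Y, C.scale Y = j → ∀ u, |t (Y, u)| ≤ E₁ * Real.exp (-(κ * C.d Y))) →
        ∀ u, ‖S.insA g k t u - S.insA g k 0 u‖ ≤ S.rHist k * (c * (ω ^ (k - 1 - j) * E₁)))
    (hE₁ : 0 < E₁) (hGop : 0 ≤ Gop) (hGhist : 0 ≤ Ghist) (hδ : 0 ≤ δ) (hδ' : 0 ≤ δ') (hθ : 0 ≤ θ) (hθθ' : θ ≤ θ')
    (hθ'1 : θ' ≤ 1) (hc : 0 ≤ c) (hω : 0 < ω) (hρ₀ : ρ₀ < 1)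
    (hnear : (δ + δ') * θ ^ k₀ + c * (EA₀ + E₀) / (1 - ω) ≤ ρ₀) (hB : 0 ≤ B) (hfirst : ∀ k < k₀, EA₀ + E₀ ≤ B * θ ^ k)
    (hsmall : ω + Ghist / (1 - ρ₀) * c < θ') :
    NE5 EA EB W κ θ'
      ((Gop / (1 - ρ₀) * δ + Ghist / (1 - ρ₀) * δ' + B) * (θ' - ω) / (θ' - (ω + Ghist / (1 - ρ₀) * c))) :=
  ne5_of_ne5_lift hρ (ne5_at_of_stepModel_fibreCl₂_scale_nat hrA hrB hbase (opFibreEnvelopeCl_of_pointwise S hopF)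
    (histFibreEnvelopeCl_of_pointwise S hhistF) (decayBound_liftA_of ρ hdA) (decayBound_liftB_of ρ hdB)
    ((S.operatorRate_iff_pointwise W δ θ).2 hop) (S.insertionRate_of_pointwise hins) haff hblind hhom
    (insScaleBound_of_pointwise S hunit) hE₁ hGop hGhist hδ hδ' hθ hθθ' hθ'1 hc hω hρ₀ hnear hB hfirst hsmall)

/-- [folklore] **NE5 OVER `C` FROM FAMILY SLOTS WITH POINTWISE TERMWISE DATA — THE (2.14)-ROADS' ROAD-D FACE** (nonempty chart onto
the run-B backgrounds).  Representation of the two runs' lifts, admissibility of run B's family data, a POINTWISE class `K k g u`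
containing the pointwise two-margin box around every admissible coordinate (the slack, per chart point), the POINTWISE termwise
data — the expansion `HasSum (T k · q.1 q.2 (X, u)) (Out k q.1 q.2 (X, u))` at every pointwise class point, termwise majorants
`a k i · e^{−κd}` there, the chart-free budget `TermBudget a G`, per-term disc analyticity along pointwise segments in the class
(W2 in the currency of E1 ∕ E8[rec] ∕ E9[rec]) — the two runs' decay bounds over `C`, the POINTWISE operator ∕ insertion rates,
the structure of the family insertion with the POINTWISE single-scale bound, and the numerics (`ω + G·c/(1 − ρ₀) < θ′`) ⟹
`T4OutputRate.NE5 EA EB W κ θ′ C₅` with the constant of `T4InputCauchyRateTermwise.ne5_at_of_stepModel_termwise_slack_scale_nat`,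
applied to `S.toStepModel`, `famClass K`, `famTerm T` and transferred by `ne5_of_ne5_lift`.  Nothing of the kernel re-proved. -/
theorem ne5_of_familySlots_termwise [Nonempty 𝒰] {ρ : 𝒰 → C.BgB} (hρ : Surjective ρ) {EA : Functional C C.BgA}
    {EB : Functional C C.BgB} {W : Set (ℕ → ℝ)} {K : ℕ → (ℕ → ℝ) → 𝒰 → Set (Op × Hist)}
    {T : ℕ → ι → Op → Hist → C.Dom × 𝒰 → ℂ} {a : ℕ → ι → ℝ} {κ G EA₀ E₀ E₁ δ δ' θ θ' c ω ρ₀ B : ℝ} {k₀ : ℕ}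
    (hrA : S.toStepModel.RepresentsA (liftA ρ EA) W) (hrB : S.toStepModel.RepresentsB (liftB ρ EB) W)
    (hbase : S.toStepModel.InBase (liftB ρ EB) W)
    (hbox : ∀ k, ∀ g ∈ W, ∀ p ∈ S.Base k g, ∀ u : 𝒰,
      closedBall (p.1 u) (S.rOp k) ×ˢ closedBall (p.2 u) (S.rHist k) ⊆ K k g u)
    (hrep : ∀ k, ∀ g ∈ W, ∀ (u : 𝒰) (q : Op × Hist), q ∈ K k g u → ∀ X : C.Dom, C.scale X = k →
      HasSum (fun i => T k i q.1 q.2 (X, u)) (S.Out k q.1 q.2 (X, u)))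
    (hbd : ∀ k, ∀ g ∈ W, ∀ (u : 𝒰) (q : Op × Hist), q ∈ K k g u → ∀ X : C.Dom, C.scale X = k →
      ∀ i, ‖T k i q.1 q.2 (X, u)‖ ≤ a k i * Real.exp (-(κ * C.d X)))
    (hbud : TermBudget a G)
    (hline : ∀ k, ∀ g ∈ W, ∀ (w : 𝒰) (o u : Op) (h₀ v : Hist),
      (∀ ζ ∈ closedBall (0 : ℂ) 1, (o + ζ • u, h₀ + ζ • v) ∈ K k g w) → ∀ X : C.Dom, C.scale X = k →
        ∀ i, DifferentiableOn ℂ (fun ζ : ℂ => T k i (o + ζ • u) (h₀ + ζ • v) (X, w)) (closedBall 0 1))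
    (hdA : DecayBound EA W EA₀ κ) (hdB : DecayBound EB W E₀ κ)
    (hop : ∀ k, ∀ g ∈ W, ∀ u : 𝒰, ‖S.opA g k u - S.opB g k u‖ ≤ δ * θ ^ k * S.rOp k)
    (hins : ∀ k, ∀ g ∈ W, ∀ (t : C.Dom × 𝒰 → ℝ), (∀ Y u, |t (Y, u)| ≤ E₀ * Real.exp (-(κ * C.d Y))) →
      ∀ u, ‖S.insA g k t u - S.insB g k t u‖ ≤ δ' * θ ^ k * S.rHist k)
    (haff : S.toStepModel.InsAffine W) (hblind : S.toStepModel.InsBlind W) (hhom : S.toStepModel.InsHomog W)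
    (hunit : ∀ k, ∀ g ∈ W, ∀ (t : C.Dom × 𝒰 → ℝ) (j : ℕ), j < k → (∀ Y u, C.scale Y ≠ j → t (Y, u) = 0) →
      (∀ Y, C.scale Y = j → ∀ u, |t (Y, u)| ≤ E₁ * Real.exp (-(κ * C.d Y))) →
        ∀ u, ‖S.insA g k t u - S.insA g k 0 u‖ ≤ S.rHist k * (c * (ω ^ (k - 1 - j) * E₁)))
    (hE₁ : 0 < E₁) (hG : 0 ≤ G) (hδ : 0 ≤ δ) (hδ' : 0 ≤ δ') (hθ : 0 ≤ θ) (hθθ' : θ ≤ θ') (hθ'1 : θ' ≤ 1) (hc : 0 ≤ c)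
    (hω : 0 < ω) (hρ₀ : ρ₀ < 1) (hnear : (δ + δ') * θ ^ k₀ + c * (EA₀ + E₀) / (1 - ω) ≤ ρ₀) (hB : 0 ≤ B)
    (hfirst : ∀ k < k₀, EA₀ + E₀ ≤ B * θ ^ k) (hsmall : ω + G / (1 - ρ₀) * c < θ') :
    NE5 EA EB W κ θ' ((G / (1 - ρ₀) * δ + G / (1 - ρ₀) * δ' + B) * (θ' - ω) / (θ' - (ω + G / (1 - ρ₀) * c))) :=
  ne5_of_ne5_lift hρ (ne5_at_of_stepModel_termwise_slack_scale_nat S.toStepModel (famClass K) (famTerm T) hrA hrB hbase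
    (boxInClass_of_pointwise S hbox) (termRep_of_pointwise S hrep) (termBound_of_pointwise hbd) hbud
    (termLineAnalytic_of_pointwise hline) (decayBound_liftA_of ρ hdA) (decayBound_liftB_of ρ hdB)
    ((S.operatorRate_iff_pointwise W δ θ).2 hop) (S.insertionRate_of_pointwise hins) haff hblind hhom
    (insScaleBound_of_pointwise S hunit) hE₁ hG hδ hδ' hθ hθθ' hθ'1 hc hω hρ₀ hnear hB hfirst hsmall)

end FamilySlots

end Summit.QuantumFields.BalabanUV.T4Continuum.OutputRateFunctionalTablesTermwise

end
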